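import Mathlib
import Summits.Parity.BatemanHorn.Theses.PolynomialMobius
import Summits.Parity.BatemanHorn.Theorems.PolyMobiusTail.Negative.Structure

/-!
# Crux `PolyMobiusTail` (stmt-Parity-0870), registered skeleton `Lines/stub_window_linear_le_one.lean`:
# stub P2 `stub_window_eq_tail_eventually` — for `k ≤ 1` linear members the upper cut is eventually vacuous

For `k ≤ 1`, members of degree `≤ 1`, any `θ > 0` and any `η`, eventually in `x` the window function
`Σ_{n≤x} Σ_{dᵢ∣fᵢ(n)} [x^{1-η} < ∏dᵢ ≤ x^{1+θ}]·∏μ(dᵢ)log dᵢ` EQUALS the tail function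
`Σ_{n≤x} Σ_{dᵢ∣fᵢ(n)} [x^{1-η} < ∏dᵢ]·∏μ(dᵢ)log dᵢ`.

* `k = 0`: the only tuple is the empty one and `∏∅ = 1 ≤ x^{1+θ}` for `x ≥ 1`.
* `k = 1`: a divisor `d ∣ f₀(n)⁺` with `1 ≤ n ≤ x` has `d ≤ f₀(n)⁺ ≤ B·n ≤ B·x ≤ x^{1+θ}` once
  `x^θ ≥ B` (`B = Σ|coeffs|`, `Negative.toNat_eval_le_mul_pow`).

No Bateman–Horn axiom is used (pure size).
-/

open scoped BigOperators
open Filter Finset Polynomial Asymptotics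

namespace Summit.Parity.BatemanHorn.Theorems.PolyMobiusTail.EtaFreeWindow

/-- Linear growth of a polynomial of degree `≤ 1` along `ℕ`, in `toNat` form: `g(n)⁺ ≤ B·n` for
`n ≥ 1`, with `B = Σⱼ |aⱼ|`. [folklore] -/
theorem toNat_eval_le_linear_of_natDegree_le_one (g : ℤ[X]) (hg : g.natDegree ≤ 1) :
    ∃ B : ℕ, ∀ n : ℕ, 1 ≤ n → (g.eval (n : ℤ)).toNat ≤ B * n := by
  refine ⟨∑ j ∈ Finset.range (g.natDegree + 1), (g.coeff j).natAbs, fun n hn => ?_⟩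
  refine (Negative.toNat_eval_le_mul_pow g hn).trans (Nat.mul_le_mul_left _ ?_)
  calc n ^ g.natDegree ≤ n ^ 1 := Nat.pow_le_pow_right hn hg
    _ = n := pow_one n

/-- For a fixed natural `B` and any `θ > 0`, eventually `B·x ≤ x^{1+θ}` (namely once `x^θ ≥ B`).
[folklore] -/
theorem eventually_natMul_le_rpow_one_add (B : ℕ) {θ : ℝ} (hθ : 0 < θ) :
    ∀ᶠ x : ℕ in atTop, (B : ℝ) * x ≤ (x : ℝ) ^ (1 + θ) := by
  have hB : ∀ᶠ x : ℕ in atTop, (B : ℝ) ≤ (x : ℝ) ^ θ :=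
    ((tendsto_rpow_atTop hθ).comp tendsto_natCast_atTop_atTop).eventually_ge_atTop (B : ℝ)
  filter_upwards [hB, eventually_ge_atTop 1] with x hxB hx1
  have hx0 : (0 : ℝ) < x := by exact_mod_cast hx1
  rw [Real.rpow_add hx0, Real.rpow_one, mul_comm]
  exact mul_le_mul_of_nonneg_left hxB hx0.le

/-- **Stub P2 `stub_window_eq_tail_eventually` (registered skeleton `Lines/stub_window_linear_le_one.lean`
of crux stmt-Parity-0870).** For `k ≤ 1`, members of degree `≤ 1`, any `θ > 0` and any `η`, the window
function `(x^{1-η}, x^{1+θ}]` of the Möbius tail equals the tail function `(x^{1-η}, ∞)` eventually in `x`: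
the upper cut is vacuous on the support, since for `k = 0` the only tuple is the empty one
(`∏∅ = 1 ≤ x^{1+θ}`) and for `k = 1` a divisor `d ∣ f₀(n)⁺`, `1 ≤ n ≤ x`, satisfies
`d ≤ f₀(n)⁺ ≤ B·n ≤ B·x ≤ x^{1+θ}` once `x^θ ≥ B`. Pure size; no Bateman–Horn axiom. [folklore] -/
theorem stub_window_eq_tail_eventually : ∀ (k : ℕ) (f : Fin k → ℤ[X]), k ≤ 1 →
    (∀ i, (f i).natDegree ≤ 1) → ∀ θ η : ℝ, 0 < θ →
      (fun x : ℕ => ∑ n ∈ Finset.Icc 1 x,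
        ∑ d ∈ Fintype.piFinset (fun i => (((f i).eval (n : ℤ)).toNat).divisors),
          if (x : ℝ) ^ (1 - η) < ∏ i, (d i : ℝ) ∧ ∏ i, (d i : ℝ) ≤ (x : ℝ) ^ (1 + θ) then
            ∏ i, ((ArithmeticFunction.moebius (d i) : ℝ) * Real.log (d i)) else 0)
        =ᶠ[atTop]
      (fun x : ℕ => ∑ n ∈ Finset.Icc 1 x,
        ∑ d ∈ Fintype.piFinset (fun i => (((f i).eval (n : ℤ)).toNat).divisors),
          if (x : ℝ) ^ (1 - η) < ∏ i, (d i : ℝ) then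
            ∏ i, ((ArithmeticFunction.moebius (d i) : ℝ) * Real.log (d i)) else 0) := by
  intro k f hk hdeg θ η hθ
  obtain rfl | rfl : k = 0 ∨ k = 1 := by omega
  · -- `k = 0`: the only divisor tuple is the empty one, `∏∅ = 1 ≤ x^{1+θ}` for `x ≥ 1`.
    filter_upwards [eventually_ge_atTop 1] with x hx
    refine Finset.sum_congr rfl fun n _ => Finset.sum_congr rfl fun d _ => ?_
    have hup : ∏ i, (d i : ℝ) ≤ (x : ℝ) ^ (1 + θ) := by
      rw [Finset.univ_eq_empty, Finset.prod_empty]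
      exact Real.one_le_rpow (by exact_mod_cast hx) (by linarith)
    simp only [hup, and_true]
  · -- `k = 1`: `d ∣ f₀(n)⁺ ≤ B·n ≤ B·x ≤ x^{1+θ}` eventually.
    obtain ⟨B, hB⟩ := toNat_eval_le_linear_of_natDegree_le_one (f 0) (hdeg 0)
    filter_upwards [eventually_natMul_le_rpow_one_add B hθ] with x hx
    refine Finset.sum_congr rfl fun n hn => Finset.sum_congr rfl fun d hd => ?_
    obtain ⟨hn1, hnx⟩ := Finset.mem_Icc.mp hn
    have hd0 : d 0 ≤ B * x :=
      (Nat.divisor_le (Fintype.mem_piFinset.mp hd 0)).trans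
        ((hB n hn1).trans (Nat.mul_le_mul_left _ hnx))
    have hup : ∏ i, (d i : ℝ) ≤ (x : ℝ) ^ (1 + θ) := by
      rw [Fin.prod_univ_one]
      exact le_trans (by exact_mod_cast hd0) hx
    simp only [hup, and_true]

end Summit.Parity.BatemanHorn.Theorems.PolyMobiusTail.EtaFreeWindow
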